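import Literature.Geometry.Symplectic.CanonicalClass
import Literature.AlgebraicTopology.SingularHomology.WuClasses
import Literature.AlgebraicTopology.SingularHomology.CohomologyRingChange
import HarnessLib

/-!
# `c₁(TM, J) ≡ v₂(M) (mod 2)` for closed almost complex `4`-manifolds (named fact)

Topic `Literature/Geometry/Symplectic`.  ONE named fact, no proofs; light file (vocabulary imports only:
`AlmostComplexStructure.firstChernClass` of `CanonicalClass`, `wuClass` of `WuClasses`,
`singularCohomology.ringChange` of `CohomologyRingChange`).

For a closed connected smooth `4`-manifold `M` with a `C^∞` almost complex structure `J`, the mod-2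
reduction of the first Chern class `c₁(TM, J) ∈ H²(M; ℤ)` is the second Wu class `v₂(M) ∈ H²(M; ℤ/2)`.
This is the conjunction of two printed theorems: (i) for a complex vector bundle the mod-2 reductions
of the Chern classes are the even Stiefel–Whitney classes of the underlying real bundle,
`w₂(E_ℝ) ≡ c₁(E) (mod 2)` (Milnor–Stasheff 1974, Problem 14-B; for `E = (TM, J)`: `w₂(TM) ≡ c₁(TM, J)`);
(ii) Wu's formula `v₂ = w₂ + w₁²` for closed manifolds (Milnor–Stasheff Thm. 11.14; Kirby 1989 Ch. II
§4 p. 23: on a closed oriented `4`-manifold "`ω₂` is characterized by `ω₂ ∪ x = x ∪ x` for all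
`x ∈ H²(M; ℤ/2)`", i.e. `w₂(TM) = v₂(M)` since `w₁ = 0`), an almost complex manifold being oriented.
McDuff–Salamon 2017, Rem. 4.1.10 (pp. 161–162) quote exactly this input as "`c` is an integral lift
of the second Stiefel–Whitney class `w₂(TM)`" in the proof that `1 − b₁ + b⁺` is even.

The statement below is, character for character, hypothesis `hV` of the accepted theorems
`even_one_add_bOne_add_bPlus_almostComplex_four_of_hirzebruch_of_wuClass` and
`even_one_add_bOne_add_bPlus_of_symplectic_four_of_hirzebruch_of_wuClass`
(`EulerCharacteristicAddSignatureOfSymplecticFourProofs.lean`), which close the named fact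
`even_one_add_bOne_add_bPlus_of_symplectic_four` (3 dependents under `Summits/SmoothPoincare4`) modulo
this fact and `hirzebruch_firstChernClass_sq_eq_almostComplex_four`
(`HirzebruchSignatureAlmostComplexFour.lean`, the sibling vendored from promote event 3140251).
Vendored by the librarian (sweep g27) at the request of the proving seat (promote events 3473716,
3488935), which may not file named facts itself.  The tree has no Stiefel–Whitney classes of real
vector bundles yet, which is why the fact is stated directly in its Wu-class form; once `w₂` of a real
bundle exists, (i) and (ii) become two separate citable statements and this one a corollary.
Deliberately NOT here: `w₂`, Wu's formula in general degree, anything in dimension `≠ 4`.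

## References

* J. Milnor, J. Stasheff, *Characteristic Classes*, Ann. of Math. Stud. 76 (1974), Thm. 11.14,
  Problem 14-B. [MilnorStasheff1974]
* R. Kirby, *The Topology of 4-Manifolds*, LNM 1374 (1989), Ch. II §4 p. 23. [Kirby1989]
* D. McDuff, D. Salamon, *Introduction to Symplectic Topology*, 3rd ed., OUP (2017), Rem. 4.1.10
  (pp. 161–162). [McDuffSalamon2017]
-/

noncomputable section

namespace Literature.Geometry.Symplectic

open scoped _root_.Manifold ContDiff
open Literature.AlgebraicTopology.SingularHomology

/-- **`c₁(TM, J) mod 2 = v₂(M)` for a closed connected almost complex `4`-manifold.**  For every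
closed connected smooth `4`-manifold `M` and every `C^∞` almost complex structure `J` on `M`, the image
of `c₁(TM, J) ∈ H²(M; ℤ)` under the coefficient change `ℤ → ℤ/2` is the Wu class `v₂(M) ∈ H²(M; ℤ/2)`:
`w₂(TM) ≡ c₁(TM, J) (mod 2)` (Milnor–Stasheff, Problem 14-B) and `w₂(TM) = v₂(M)` on a closed oriented
`4`-manifold (Wu's formula, Milnor–Stasheff Thm. 11.14; Kirby 1989 Ch. II §4).  Verbatim hypothesis
`hV` of `even_one_add_bOne_add_bPlus_almostComplex_four_of_hirzebruch_of_wuClass`.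
[cite: MilnorStasheff1974, Thm. 11.14 and Problem 14-B] -/
def firstChernClass_modTwo_eq_wuClass_almostComplex_four : Prop :=
  ∀ (M : Type) [TopologicalSpace M] [T2Space M] [SecondCountableTopology M]
    [CompactSpace M] [ConnectedSpace M] [ChartedSpace (EuclideanSpace ℝ (Fin 4)) M]
    [IsManifold (𝓡 4) ∞ M] (J : AlmostComplexStructure (𝓡 4) ∞ M),
    singularCohomology.ringChange (algebraMap ℤ (ZMod 2)) M 2 J.firstChernClass = wuClass M 4 2

end Literature.Geometry.Symplectic

end
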